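import Summits.QuantumFields.YangMills.Theorems.UnitScaleTiltProp7CovPinCharge
import Summits.QuantumFields.YangMills.Theorems.UnitScaleTiltProp7TorusGreenPotentialBounds
import HarnessLib

/-!
# Route `UnitScaleTilt`, crux K1 «MinimiserStabilityRegPr» (stmt-QuantumFields-19200), route-R E′ path (α′), (E1-b) covariant, row (hK₂-cov) — FILE F3c-cov «PIN ROW FROM THE LAPLACIAN DEFECT»:
# THE NEAR (PIN) ROW FOR AN ARBITRARY MATRIX FIELD IN TERMS OF ITS FLAT-LAPLACIAN DEFECT OFF THE PIN —
# `tdist(x,y)·‖v x‖ ≤ 2N²·C_p·(√((2Σ_{s<ℓ∕2}‖v‖² + 2A₁ℓ²J₂)∕ℓ) + ‖Δ₁v(y)‖ + J₁) + ½√(C_K·tdist(x,y))·√J₂`, `J₁ = Σ_{0<s<ℓ∕2}‖Δ₁v‖`, `J₂ = Σ_{0<s<ℓ∕2} s²‖Δ₁v‖²`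

Cell `ym3-torus`, width seat `ym3-torus-px11` (gen 3), LEAD of the (hK₂-cov) chain (routeR-w3 g6 WORDS (8)–(10)); LOCATE 19200 evidence #57 `LOCATE-HK2COV-px11g3.md` §1 row (PIN).
`--kind proof --supports stmt-QuantumFields-19200 --as helper`, count-neutral.  THEOREMS ONLY (0 `def`, 0 `sorry`).  YM₃ on T³ is a ladder rung (R3) — not d = 4, not infinite
volume, not a mass gap, not the Clay problem; nothing here claims the stub, the crux or the gap.

THE POINT.  In the (hK₂-cov) transplant the framed field `v = R(Fr⁻¹)(Δ_Uφ_H)` is NOT flat-harmonic off the pin: `Δ₁v = −f` (frame junk) there.  Subtract the torus-Green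
POTENTIAL of the defect (px7 g3 ✓ `Prop7TorusGreenPotentialBall.laplace_one_potential`: `w := Σ_{z∈B} ½G̃(EK · − EK z)•g z`, `g := Δ₁v·𝟙_{z ≠ y}` on the ball `B = {s < ℓ∕2}`):
`ṽ := v − w` has CONSTANT flat Laplacian `κ₀ = |T|⁻¹•Σ_B g` on the punctured ball and charge `Δ₁ṽ(y) − κ₀ = Δ₁v(y)`, so px7's abstract pin row ✓
`Prop7InterpErrorPinAbstract.tdist_mul_abs_le_of_laplace_const_punctured` applies to EACH of the `2N²` real components of `ṽ`; the potential itself is paid POINTWISE by ✓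
`Prop7TorusGreenPotentialBounds.norm_potential_le` (the two-centre shell sum (C2)) and in mass by ✓ `sum_sq_norm_potential_le`.  The statement is about an ARBITRARY matrix field
`v` — no background, no frame, no harmonicity: those enter only when F4-cov bounds `J₁, J₂` by ✓ `Prop7CovPinCharge.norm_laplace_one_framed_le` + ✓ `Prop7CovPinJunkSums`.  For a
field flat-harmonic off the pin (`J₁ = J₂ = 0`) it is px7's flat (PIN) row for matrix fields.

WHAT IS PROVED (ns `…Theorems.Prop7CovInterpErrorPinRows`; torus `Site P 0`, `P.d = 3`, `k ≤ m + K`, `ℓ = L^k ≥ 1024`, pin `y = embIter k y₀`, `s = tdist(·,y)`, `L²`-op norm on `M_N(ℂ)`).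
* §1 letters: `laplace_one_sub_apply`, `mul_sqrt_div_eq` (`s·√(C∕s) = √(C·s)`), `pow_le_T` (`ℓ³ ≤ |T|`), `norm_sub_sq_le`.
* §2 ★★★ `tdist_mul_norm_le_of_laplace_defect` — the row of the title, for every `x ≠ y` with `tdist(x,y) ≤ 13(L^k∕1024) + 18`.
HONEST SCOPE.  Bookkeeping over px7 g3's landed bricks (✓p673837, ✓p674301, ✓p674783) and F3a ✓p674600; nothing of Bałaban's is asserted.

References: T. Bałaban, CMP 102 (1985) 277–309 [Balaban1985Variational] (Prop. 7 p.299); CMP 99 (1985) 75–102 [Balaban1985RegularSpaces] ((1.36) p.82).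
-/

set_option autoImplicit false

noncomputable section

open scoped BigOperators Matrix.Norms.L2Operator Matrix

namespace Summit.QuantumFields.YangMills.Theorems.Prop7CovInterpErrorPinRows

open Literature.MathematicalPhysics.QuantumFieldTheory.Balaban1983to89
open Finset
open LatticeFieldCalculus (laplace)
open B15DeterminingSets (embIter)
open B5Eq117TorusCarriers (EK)
open Literature.Probability.LatticeModels (torusGreen)
open Summit.QuantumFields.YangMills.Theorems.Prop7CovPinCharge (abs_re_im_entry_le laplace_one_re_entry laplace_one_im_entry norm_le_sum_abs_re_add_abs_im)
open Summit.QuantumFields.YangMills.Theorems.Prop7InterpErrorPinAbstract (tdist_mul_abs_le_of_laplace_const_punctured tdist_pos_of_ne)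
open Summit.QuantumFields.YangMills.Theorems.Prop7TorusGreenPotentialBall (laplace_one_potential)
open Summit.QuantumFields.YangMills.Theorems.Prop7TorusGreenPotentialBounds (norm_potential_le sum_sq_norm_potential_le)

variable {N : ℕ}

/-! ## §1 Letters -/

section Letters

variable {P : Params} {j : ℕ}

/-- `Δ₁` of a difference of matrix fields. [folklore] -/
theorem laplace_one_sub_apply (u w : Site P j → Matrix (Fin N) (Fin N) ℂ) (x : Site P j) :
    laplace 1 (fun z => u z - w z) x = laplace 1 u x - laplace 1 w x := by
  simp only [laplace, one_pow, one_smul, ← Finset.sum_sub_distrib]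
  refine Finset.sum_congr rfl fun μ _ => ?_
  abel

omit N in
/-- `s·√(C∕s) = √(C·s)` for `s > 0`. [folklore] -/
theorem mul_sqrt_div_eq {C s : ℝ} (hC : 0 ≤ C) (hs : 0 < s) : s * Real.sqrt (C / s) = Real.sqrt (C * s) := by
  rw [Real.sqrt_div' C hs.le, Real.sqrt_mul hC, mul_comm s, div_mul_eq_mul_div, mul_div_assoc, Real.div_sqrt]

omit N in
/-- `ℓ³ ≤ |T| = (L^k·sitesPerDir k)³` in `d = 3`. [folklore] -/
theorem pow_le_T (hd : P.d = 3) (k : ℕ) :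
    ((P.L : ℝ) ^ k) ^ 3 ≤ (((P.L ^ k * P.sitesPerDir k : ℕ) : ℝ)) ^ P.d := by
  rw [hd]
  refine pow_le_pow_left₀ (by positivity) ?_ 3
  have h1 : (1 : ℝ) ≤ P.sitesPerDir k := by exact_mod_cast Nat.one_le_iff_ne_zero.2 (P.sitesPerDir_ne_zero k)
  push_cast
  nlinarith [pow_nonneg (Nat.cast_nonneg (α := ℝ) P.L) k]

/-- `‖X − Y‖² ≤ 2‖X‖² + 2‖Y‖²`. [folklore] -/
theorem norm_sub_sq_le (X Y : Matrix (Fin N) (Fin N) ℂ) : ‖X - Y‖ ^ 2 ≤ 2 * ‖X‖ ^ 2 + 2 * ‖Y‖ ^ 2 := by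
  have h := norm_sub_le X Y
  nlinarith [norm_nonneg (X - Y), norm_nonneg X, norm_nonneg Y, sq_nonneg (‖X‖ - ‖Y‖)]

end Letters

/-! ## §2 ★★★ The pin row from the Laplacian defect -/

section PinRow

/-- ★★★ **THE NEAR (PIN) ROW FOR AN ARBITRARY MATRIX FIELD, IN TERMS OF ITS FLAT-LAPLACIAN DEFECT OFF THE PIN.**  There are absolute `C_p > 0`, `C_K, A₁ ≥ 0` such that for every
record with `P.d = 3`, `k ≤ m + K`, `L^k ≥ 1024`, every pin `y = embIter k y₀`, every field `v : Site P 0 → M_N(ℂ)` and every `x ≠ y` with `tdist(x,y) ≤ 13(L^k∕1024) + 18`: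
`tdist(x,y)·‖v x‖ ≤ 2N²·C_p·(√((2·Σ_{s<ℓ∕2}‖v‖² + 2·A₁·(L^k)²·J₂) ∕ L^k) + ‖Δ₁v(y)‖ + J₁) + ½·√(C_K·tdist(x,y))·√J₂`
with `J₁ := Σ_{0<s<ℓ∕2}‖Δ₁v z‖`, `J₂ := Σ_{0<s<ℓ∕2} s²·‖Δ₁v z‖²` (`s = tdist(·,y)`, `Δ₁ = laplace 1`).  (Subtract the torus-Green potential of the defect; px7's abstract pin row on
each real component of the corrected field; the potential pointwise by (C2).) [cite: Balaban1985Variational, Prop. 7 p.299; Balaban1985RegularSpaces, (1.36) p.82] -/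
theorem tdist_mul_norm_le_of_laplace_defect : ∃ Cp CK A₁ : ℝ, 0 < Cp ∧ 0 ≤ CK ∧ 0 ≤ A₁ ∧
    ∀ (P : Params) (_ : P.d = 3) (k : ℕ) (hk : k ≤ P.m + P.K) (_ : 1024 ≤ P.L ^ k) (y₀ : Site P k)
      (v : Site P 0 → Matrix (Fin N) (Fin N) ℂ) (x : Site P 0), x ≠ embIter k y₀ → Site.tdist x (embIter k y₀) ≤ 13 * (P.L ^ k / 1024) + 18 →
      (Site.tdist x (embIter k y₀) : ℝ) * ‖v x‖
        ≤ 2 * (N : ℝ) ^ 2 * Cp *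
            (Real.sqrt ((2 * ∑ z ∈ Finset.univ.filter (fun z : Site P 0 => (Site.tdist z (embIter k y₀) : ℝ) < (P.L : ℝ) ^ k / 2), ‖v z‖ ^ 2
                  + 2 * A₁ * ((P.L : ℝ) ^ k) ^ 2 *
                    ∑ z ∈ (Finset.univ.filter (fun z : Site P 0 => (Site.tdist z (embIter k y₀) : ℝ) < (P.L : ℝ) ^ k / 2)).erase (embIter k y₀),
                      ((Site.tdist z (embIter k y₀) : ℕ) : ℝ) ^ 2 * ‖laplace 1 v z‖ ^ 2) / (P.L : ℝ) ^ k)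
              + ‖laplace 1 v (embIter k y₀)‖
              + ∑ z ∈ (Finset.univ.filter (fun z : Site P 0 => (Site.tdist z (embIter k y₀) : ℝ) < (P.L : ℝ) ^ k / 2)).erase (embIter k y₀), ‖laplace 1 v z‖)
          + 2⁻¹ * Real.sqrt (CK * (Site.tdist x (embIter k y₀) : ℝ)) *
              Real.sqrt (∑ z ∈ (Finset.univ.filter (fun z : Site P 0 => (Site.tdist z (embIter k y₀) : ℝ) < (P.L : ℝ) ^ k / 2)).erase (embIter k y₀),
                ((Site.tdist z (embIter k y₀) : ℕ) : ℝ) ^ 2 * ‖laplace 1 v z‖ ^ 2) := by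
  obtain ⟨Cp, hCp, hpin⟩ := tdist_mul_abs_le_of_laplace_const_punctured
  obtain ⟨CK, C₁, hCK, hC₁, hpot⟩ := norm_potential_le (E := Matrix (Fin N) (Fin N) ℂ)
  obtain ⟨A₁, A₂, hA₁, hA₂, hmass⟩ := sum_sq_norm_potential_le (E := Matrix (Fin N) (Fin N) ℂ)
  refine ⟨Cp, CK, A₁, hCp, hCK, hA₁, ?_⟩
  intro P hd k hk hℓk y₀ v x hxy hx
  classical
  -- letters
  set y : Site P 0 := embIter k y₀ with hydef
  set ℓ : ℝ := (P.L : ℝ) ^ k with hℓdef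
  have hL1 : (1 : ℝ) ≤ (P.L : ℝ) := by exact_mod_cast P.L_pos
  have hℓ1 : 1 ≤ ℓ := one_le_pow₀ hL1
  have hℓ0 : 0 < ℓ := by linarith
  set B : Finset (Site P 0) := Finset.univ.filter (fun z : Site P 0 => (Site.tdist z y : ℝ) < ℓ / 2) with hBdef
  have hyB : y ∈ B := by
    rw [hBdef, Finset.mem_filter]; refine ⟨Finset.mem_univ _, ?_⟩
    rw [B3Taylor310LocalRemainder.tdist_self]; push_cast; linarith
  have hBR : ∀ z ∈ B, Site.tdist z y ≤ P.L ^ k := by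
    intro z hz
    rw [hBdef, Finset.mem_filter] at hz
    have h : (Site.tdist z y : ℝ) ≤ (P.L : ℝ) ^ k := by linarith [hz.2]
    exact_mod_cast h
  have hR1 : 1 ≤ P.L ^ k := Nat.one_le_pow _ _ P.L_pos
  -- the defect source and its potential
  set g : Site P 0 → Matrix (Fin N) (Fin N) ℂ := fun z => if z = y then 0 else laplace 1 v z with hgdef
  set w : Site P 0 → Matrix (Fin N) (Fin N) ℂ :=
    fun x => ∑ z ∈ B, ((2 : ℝ)⁻¹ * torusGreen (L := P.L ^ k * P.sitesPerDir k) (EK hk x - EK hk z)) • g z with hwdef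
  have hw : ∀ x, w x = ∑ z ∈ B, ((2 : ℝ)⁻¹ * torusGreen (L := P.L ^ k * P.sitesPerDir k) (EK hk x - EK hk z)) • g z := fun x => rfl
  have hgy : g y = 0 := by simp [hgdef]
  have hgz : ∀ z, z ≠ y → g z = laplace 1 v z := fun z hz => by simp [hgdef, hz]
  set T : ℝ := (((P.L ^ k * P.sitesPerDir k : ℕ) : ℝ)) ^ P.d with hTdef
  have hT0 : 0 < T := by
    rw [hTdef]; exact pow_pos (by exact_mod_cast Nat.pos_of_ne_zero (mul_ne_zero (pow_ne_zero _ P.L_pos.ne') (P.sitesPerDir_ne_zero k))) _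
  have hℓT : ℓ ^ 3 ≤ T := pow_le_T hd k
  set κ₀ : Matrix (Fin N) (Fin N) ℂ := T⁻¹ • ∑ z ∈ B, g z with hκdef
  -- the corrected field and its flat Laplacian
  set vt : Site P 0 → Matrix (Fin N) (Fin N) ℂ := fun z => v z - w z with hvt
  have hlapw : ∀ z, laplace 1 w z = (if z ∈ B then g z else 0) - κ₀ := fun z => laplace_one_potential hk B g w hw z
  have hlapvt : ∀ z, laplace 1 vt z = laplace 1 v z - ((if z ∈ B then g z else 0) - κ₀) := fun z => by
    rw [hvt, laplace_one_sub_apply, hlapw]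
  have hconst : ∀ z, 0 < Site.tdist z y → (Site.tdist z y : ℝ) < ℓ / 2 → laplace 1 vt z = κ₀ := by
    intro z hz0 hzℓ
    have hzB : z ∈ B := by rw [hBdef, Finset.mem_filter]; exact ⟨Finset.mem_univ _, hzℓ⟩
    have hzy : z ≠ y := by
      intro h; rw [h, B3Taylor310LocalRemainder.tdist_self] at hz0; exact lt_irrefl _ hz0
    rw [hlapvt, if_pos hzB, hgz z hzy]; abel
  have hcharge : laplace 1 vt y - κ₀ = laplace 1 v y := by
    rw [hlapvt, if_pos hyB, hgy]; abel
  -- names for the sums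
  set Mv : ℝ := ∑ z ∈ B, ‖v z‖ ^ 2 with hMv
  set J1 : ℝ := ∑ z ∈ B.erase y, ‖laplace 1 v z‖ with hJ1
  set J2 : ℝ := ∑ z ∈ B.erase y, ((Site.tdist z y : ℕ) : ℝ) ^ 2 * ‖laplace 1 v z‖ ^ 2 with hJ2
  have hMv0 : 0 ≤ Mv := Finset.sum_nonneg fun _ _ => sq_nonneg _
  have hJ10 : 0 ≤ J1 := Finset.sum_nonneg fun _ _ => norm_nonneg _
  have hJ20 : 0 ≤ J2 := Finset.sum_nonneg fun _ _ => by positivity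
  -- `S` of px7's bounds equals `J2` (`g = Δ₁v` off `y`)
  have hSJ : ∑ z ∈ B.erase y, ((Site.tdist z y : ℕ) : ℝ) ^ 2 * ‖g z‖ ^ 2 = J2 := by
    rw [hJ2]; exact Finset.sum_congr rfl fun z hz => by rw [hgz z (Finset.mem_erase.1 hz).1]
  -- (a) mass of the potential and of the corrected field
  have hwmass : ∑ z ∈ B, ‖w z‖ ^ 2 ≤ A₁ * ((P.L ^ k : ℕ) : ℝ) ^ 2 * J2 := by
    have h := hmass P hd k hk y B (P.L ^ k) hR1 hBR hyB g w hw
    rw [hSJ, hgy, norm_zero] at h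
    simpa using h
  have hℓN : ((P.L ^ k : ℕ) : ℝ) = ℓ := by push_cast; rfl
  rw [hℓN] at hwmass
  have hvtmass : ∑ z ∈ B, ‖vt z‖ ^ 2 ≤ 2 * Mv + 2 * A₁ * ℓ ^ 2 * J2 := by
    calc ∑ z ∈ B, ‖vt z‖ ^ 2 ≤ ∑ z ∈ B, (2 * ‖v z‖ ^ 2 + 2 * ‖w z‖ ^ 2) := Finset.sum_le_sum fun z _ => norm_sub_sq_le _ _
      _ = 2 * Mv + 2 * ∑ z ∈ B, ‖w z‖ ^ 2 := by rw [Finset.sum_add_distrib, ← Finset.mul_sum, ← Finset.mul_sum]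
      _ ≤ 2 * Mv + 2 * (A₁ * ℓ ^ 2 * J2) := by linarith
      _ = _ := by ring
  -- (b) `ℓ³‖κ₀‖ ≤ J1`
  have hκ : ℓ ^ 3 * ‖κ₀‖ ≤ J1 := by
    have h1 : ‖κ₀‖ ≤ T⁻¹ * J1 := by
      rw [hκdef, norm_smul, Real.norm_eq_abs, abs_of_pos (inv_pos.2 hT0)]
      refine mul_le_mul_of_nonneg_left ?_ (inv_pos.2 hT0).le
      rw [← Finset.add_sum_erase B g hyB, hgy, zero_add, hJ1]
      exact (norm_sum_le _ _).trans (Finset.sum_le_sum fun z hz => by rw [hgz z (Finset.mem_erase.1 hz).1])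
    calc ℓ ^ 3 * ‖κ₀‖ ≤ ℓ ^ 3 * (T⁻¹ * J1) := mul_le_mul_of_nonneg_left h1 (by positivity)
      _ = (ℓ ^ 3 / T) * J1 := by ring
      _ ≤ 1 * J1 := mul_le_mul_of_nonneg_right ((div_le_one hT0).2 hℓT) hJ10
      _ = J1 := one_mul _
  -- (c) ONE real component of the corrected field: `u = proj ∘ ṽ` for a norm-bounded additive real functional `proj`
  set Q : ℝ := Real.sqrt ((2 * Mv + 2 * A₁ * ℓ ^ 2 * J2) / ℓ) + ‖laplace 1 v y‖ + J1 with hQ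
  have hs0 : (0 : ℝ) ≤ Site.tdist x y := Nat.cast_nonneg _
  have hcomp : ∀ (proj : Matrix (Fin N) (Fin N) ℂ → ℝ), (∀ X, |proj X| ≤ ‖X‖) → (∀ X Y, proj (X - Y) = proj X - proj Y) →
      (∀ z, laplace 1 (fun w' => proj (vt w')) z = proj (laplace 1 vt z)) →
      (Site.tdist x y : ℝ) * |proj (vt x)| ≤ Cp * Q := by
    intro proj hproj hsub hlapu
    have hu1 : ∀ z : Site P 0, 0 < Site.tdist z y → (Site.tdist z y : ℝ) < (P.L : ℝ) ^ k / 2 → laplace 1 (fun w' => proj (vt w')) z = proj κ₀ := by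
      intro z hz0 hzℓ; rw [hlapu, hconst z hz0 hzℓ]
    have hu2 : ∑ z ∈ Finset.univ.filter (fun z : Site P 0 => (Site.tdist z y : ℝ) < (P.L : ℝ) ^ k / 2), (proj (vt z)) ^ 2 ≤ 2 * Mv + 2 * A₁ * ℓ ^ 2 * J2 := by
      refine le_trans (Finset.sum_le_sum fun z _ => ?_) hvtmass
      rw [← sq_abs]; exact pow_le_pow_left₀ (abs_nonneg _) (hproj (vt z)) 2
    have h := hpin P hd k hk hℓk y₀ (fun w' => proj (vt w')) (proj κ₀) hu1 _ hu2 x hx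
    have hq : |laplace 1 (fun w' => proj (vt w')) y - proj κ₀| ≤ ‖laplace 1 v y‖ := by
      rw [hlapu, ← hsub, hcharge]; exact hproj _
    have hκ' : ((P.L : ℝ) ^ k) ^ 3 * |proj κ₀| ≤ J1 :=
      le_trans (mul_le_mul_of_nonneg_left (hproj κ₀) (by positivity)) hκ
    calc (Site.tdist x y : ℝ) * |proj (vt x)| ≤ _ := h
      _ ≤ Cp * Q := by
          rw [hQ]
          refine mul_le_mul_of_nonneg_left ?_ hCp.le
          linarith
  -- (d) sum over the `2N²` real components
  have hre : ∀ j k' : Fin N, (Site.tdist x y : ℝ) * |((vt x) j k').re| ≤ Cp * Q := fun j k' =>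
    hcomp (fun X => (X j k').re) (fun X => (abs_re_im_entry_le X j k').1) (fun X Y => by simp [Matrix.sub_apply])
      (fun z => laplace_one_re_entry vt z j k')
  have him : ∀ j k' : Fin N, (Site.tdist x y : ℝ) * |((vt x) j k').im| ≤ Cp * Q := fun j k' =>
    hcomp (fun X => (X j k').im) (fun X => (abs_re_im_entry_le X j k').2) (fun X Y => by simp [Matrix.sub_apply])
      (fun z => laplace_one_im_entry vt z j k')
  have hvt_pt : (Site.tdist x y : ℝ) * ‖vt x‖ ≤ 2 * (N : ℝ) ^ 2 * Cp * Q := by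
    calc (Site.tdist x y : ℝ) * ‖vt x‖ ≤ (Site.tdist x y : ℝ) * ∑ j : Fin N, ∑ k' : Fin N, (|((vt x) j k').re| + |((vt x) j k').im|) :=
          mul_le_mul_of_nonneg_left (norm_le_sum_abs_re_add_abs_im _) hs0
      _ = ∑ j : Fin N, ∑ k' : Fin N, ((Site.tdist x y : ℝ) * |((vt x) j k').re| + (Site.tdist x y : ℝ) * |((vt x) j k').im|) := by
          rw [Finset.mul_sum]; refine Finset.sum_congr rfl fun j _ => ?_
          rw [Finset.mul_sum]; refine Finset.sum_congr rfl fun k' _ => ?_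
          ring
      _ ≤ ∑ _j : Fin N, ∑ _k' : Fin N, (Cp * Q + Cp * Q) := Finset.sum_le_sum fun j _ => Finset.sum_le_sum fun k' _ => add_le_add (hre j k') (him j k')
      _ = 2 * (N : ℝ) ^ 2 * Cp * Q := by
          simp only [Finset.sum_const, Finset.card_univ, Fintype.card_fin, nsmul_eq_mul]; ring
  -- (e) the potential, pointwise (the pole term vanishes: `g y = 0`)
  have hxR : Site.tdist x y ≤ P.L ^ k := by
    have h1024 := hℓk
    have : 13 * (P.L ^ k / 1024) + 18 ≤ P.L ^ k := by omega
    exact hx.trans this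
  have hsx : (0 : ℝ) < Site.tdist x y := by exact_mod_cast tdist_pos_of_ne hxy
  have hw_pt : (Site.tdist x y : ℝ) * ‖w x‖ ≤ 2⁻¹ * Real.sqrt (CK * (Site.tdist x y : ℝ)) * Real.sqrt J2 := by
    have h := hpot P hd k hk y B (P.L ^ k) hBR hyB g w hw x hxy hxR
    rw [hSJ, hgy, norm_zero, mul_zero, zero_div, add_zero] at h
    calc (Site.tdist x y : ℝ) * ‖w x‖ ≤ (Site.tdist x y : ℝ) * (2⁻¹ * Real.sqrt (CK / (Site.tdist x y : ℝ)) * Real.sqrt J2) :=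
          mul_le_mul_of_nonneg_left h hs0
      _ = 2⁻¹ * ((Site.tdist x y : ℝ) * Real.sqrt (CK / (Site.tdist x y : ℝ))) * Real.sqrt J2 := by ring
      _ = _ := by rw [mul_sqrt_div_eq hCK hsx]
  -- (f) assemble: `v = ṽ + w`
  have hsplit : ‖v x‖ ≤ ‖vt x‖ + ‖w x‖ := by
    have e : v x = vt x + w x := by rw [hvt]; simp
    rw [e]; exact norm_add_le _ _
  calc (Site.tdist x y : ℝ) * ‖v x‖ ≤ (Site.tdist x y : ℝ) * ‖vt x‖ + (Site.tdist x y : ℝ) * ‖w x‖ := by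
        rw [← mul_add]; exact mul_le_mul_of_nonneg_left hsplit hs0
    _ ≤ 2 * (N : ℝ) ^ 2 * Cp * Q + 2⁻¹ * Real.sqrt (CK * (Site.tdist x y : ℝ)) * Real.sqrt J2 := add_le_add hvt_pt hw_pt
    _ = _ := by rw [hQ]

end PinRow

end Summit.QuantumFields.YangMills.Theorems.Prop7CovInterpErrorPinRows

end
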